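import Summits.ResolutionOfSingularities.ResolutionOfSingularities.Theorems.EquisingularLiftEquisingularLiftNatSecondOrderGraphChartData
import HarnessLib

/-!
# [OURS] CHARTS WITH A REGULAR ORIGIN CARRY (TRIVIAL) SECOND-ORDER DATA: `G = c·T_l + q`, `c ≠ 0`, `q ∈ (T)²` splits with `Φ' = c·T_l` and one-step data —
# the `hsec` input of ✓ `OneStep.twoStepAt_origin` / ✓ `twoStepAt_vertex` for the charts of ✓ `A_ladder_chart₂` (`c ≠ 0`) and ✓ `doublePlane_ladder_chart` (`c ≠ 0`)
# (cruxes `Theses.EquisingularLift.EquisingularLiftNat` / `…NatThree` / `EquisingularLift`, stmt-…-20038 / -20148 / -15660)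

[OURS · leafhand-res-equisingularlift-11 g0, 2026-08-31; cell `pub/decomp-res`] AI-produced, weaker than expert review; NOT a statement of any manuscript;
nothing here proves resolution of singularities in positive characteristic.  DEF-FREE helper; no `sorry`; standard axioms; ZERO named hypotheses.

Companion of ✓ `SecondOrderPoint.secondOrderData_of_graphChart` (p834097).  The ladder theorems ✓ `A_ladder_chart₂` / ✓ `doublePlane_ladder_chart` present a
chart's strict transform as `G = C(c)·T_l + (quadratic form) + T_l·p₂`; when `c ≠ 0` the chart origin is a regular point of the strict transform, and the
second-order splitting asked by the scheme-side theorems is the trivial one: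

* `SecondOrderPoint.firstOrder_linear_unit` — (FO) for a linear form with `∂_lΦ' = C c`, `c ≠ 0`: vacuous;
* ★ `SecondOrderPoint.secondOrderData_of_regularOrigin` — `G = C c * X l + q` with `c ≠ 0`, `q ∈ (T)²` ⟹ the data `∃ μ' = 1, Φ' = c·T_l, Ψ' = q, …, hone'`.

Honest label: pure algebra; closes no registered stub.

References: [Hartshorne1977, I Thm. 5.1]; through the cited tree files.
-/

set_option linter.dupNamespace false -- mandated namespace `Summit.<Summit>.<Problem>` of this single-conjunct summit

noncomputable section

open MvPolynomial

namespace Summit.ResolutionOfSingularities.ResolutionOfSingularities.Cruxes.EquisingularLiftNat.Sections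

namespace SecondOrderPoint

variable (K : Type) [Field K] {n : ℕ}

/-- **(FO) for a linear form with a non-zero constant partial is vacuous.** [folklore] -/
theorem firstOrder_linear_unit {Φ' : MvPolynomial (Fin n) K} (l : Fin n) {c : K} (hc : c ≠ 0) (hl : pderiv l Φ' = C c)
    (Ψ₁ : MvPolynomial (Fin n) K) (P : Ideal (MvPolynomial (Fin n) K)) (hP : P.IsPrime) (_hΦ : Φ' ∈ P) (hd : ∀ i, pderiv i Φ' ∈ P)
    (_hΨ : Ψ₁ ∈ P) (i : Fin n) : (X i : MvPolynomial (Fin n) K) ∈ P := by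
  exfalso
  have h := hd l
  rw [hl] at h
  exact hP.ne_top (P.eq_top_of_isUnit_mem h ((isUnit_iff_ne_zero.mpr hc).map C))

/-- ★ **A CHART WITH A REGULAR ORIGIN CARRIES SECOND-ORDER DATA**: `G = c·T_l + q`, `c ≠ 0`, `q ∈ (T)²` ⟹ `G = Φ' + Ψ'` with `Φ' = c·T_l` a non-zero linear
form, `Ψ' = q`, and one-step data in every chart direction (✓ `FirstOrderPoint.exists_strictTransform` with `μ = 1`, the quadratic part split off by
✓ `sub_homogeneousComponent_mem_pow_succ`). [cite: Hartshorne1977, I Thm. 5.1] -/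
theorem secondOrderData_of_regularOrigin (l : Fin n) {c : K} (hc : c ≠ 0) {q : MvPolynomial (Fin n) K}
    (hq : q ∈ Ideal.span (Set.range (X : Fin n → MvPolynomial (Fin n) K)) ^ 2) :
    ∃ (μ' : ℕ) (Φ' Ψ' : MvPolynomial (Fin n) K), 1 ≤ μ' ∧ Φ'.IsHomogeneous μ' ∧ Φ' ≠ 0 ∧
      Ψ' ∈ Ideal.span (Set.range (X : Fin n → MvPolynomial (Fin n) K)) ^ (μ' + 1) ∧ C c * X l + q = Φ' + Ψ' ∧
      ∀ b : Fin n, ∃ G' : MvPolynomial (Fin n) K,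
        aeval (fun i => X b * Function.update (X : Fin n → MvPolynomial (Fin n) K) b 1 i) (Φ' + Ψ') = X b ^ μ' * G' ∧
        ∀ P : Ideal (MvPolynomial (Fin n) K), P.IsPrime → (X b : MvPolynomial (Fin n) K) ∈ P → G' ∈ P → ∃ i, pderiv i G' ∉ P := by
  have hΦ' : (C c * X l : MvPolynomial (Fin n) K).IsHomogeneous 1 := by
    simpa using (isHomogeneous_C (Fin n) c).mul (isHomogeneous_X K l)
  have hdl : pderiv l (C c * X l : MvPolynomial (Fin n) K) = C c := by
    rw [pderiv_C_mul, pderiv_X_self, mul_one]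
  have hΦ'0 : (C c * X l : MvPolynomial (Fin n) K) ≠ 0 :=
    mul_ne_zero (by rwa [Ne, C_eq_zero]) (X_ne_zero l)
  -- split `q` into its quadratic part and an order-≥3 tail
  have hq₂ : (homogeneousComponent 2 q).IsHomogeneous (1 + 1) := homogeneousComponent_isHomogeneous 2 q
  have hq₃ : q - homogeneousComponent 2 q ∈ Ideal.span (Set.range (X : Fin n → MvPolynomial (Fin n) K)) ^ (1 + 2) :=
    sub_homogeneousComponent_mem_pow_succ K hq
  refine ⟨1, C c * X l, q, le_rfl, hΦ', hΦ'0, hq, rfl, fun b => ?_⟩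
  have hsplit : (C c * X l + q : MvPolynomial (Fin n) K) = C c * X l + (homogeneousComponent 2 q + (q - homogeneousComponent 2 q)) := by ring
  rw [hsplit]
  exact FirstOrderPoint.exists_strictTransform K (C c * X l) (homogeneousComponent 2 q) (q - homogeneousComponent 2 q) hΦ' hq₂ hq₃
    (fun P hP hΦP hdP hΨP => firstOrder_linear_unit K l hc hdl _ P hP hΦP hdP hΨP) b

end SecondOrderPoint

end Summit.ResolutionOfSingularities.ResolutionOfSingularities.Cruxes.EquisingularLiftNat.Sections

end
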